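/-
Copyright (c) 2026 the pub-hodgecm-mathlib formalisation cell (harness21).  Prover seat hodgecm-mathlib-K2E3-p23 (g8), Track B «K2-LIT» ∕ hLiu418 #184♮,
Road I v3, unit U5 «THE CLOSE», FACE-D₀ row `h2₂`: THE S-LETTERS OF ★ U2a's σ-EXPLICIT LINE MODEL AT ONE FINITE PLACE `v` — PART 3, THE ONE ∃-PACKAGE.  THEOREMS ONLY.
-/
import Summits.HodgeConjecture.HodgeConjecture.Theorems.K2LiuFinLineModelLettersAtPlaceC   -- ★ p864243 PART 2b (brings ★ p864061 PART 1, ★ p864126 PART 2a, ★ p863978, ★ p863716)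
import HarnessLib

/-!
# K2_Liu road (hLiu418 = stmt-HodgeConjecture-24832), U5 «THE CLOSE», FACE-D₀ row `h2₂`: ALL THE S-LETTERS OF ★ U2a's LINE MODEL AT THE PLACE `v`, IN ONE ∃-PACKAGE

Cell `pub/hodgecm-mathlib` (D-0151), Track B, build stream 29; helper lane `--supports stmt-HodgeConjecture-24832 --as helper`, count-neutral; closes no socket.
THEOREMS ONLY (no `def`, no `instance`, no notation, no named-fact hypothesis, no `sorry`).

**`exists_letters`** — at the instance `R := L ⊗ L⁺_v`, `F := L⁺_v`, `σ := conjLocal L c v`, `ψ := ψ_{L⁺,v}`, `Z := N_Δ(L⁺_v)`, `ι := ι_v` of ★ p863332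
`K2LiuFirstTermLineLiftRankRowModelConj.h2Row_thetaSide_of_finLineModel_conj` ∕ K2Liu-p02's `K2LiuFirstTermLineLiftRankRowCayley[Fst].h2Row_thetaSide_of_lineCayley[_fst]`:
given the re-enumeration `ρ : Fin n ≃ Fin 2` (`N = 2`, `M = 1`), the line-pair enumeration `e₁`, the line `a′`, a `T`-skew Fourier index `S` with `det S ≠ 0`, and the finite
multiplier representation `ρf` of `N_Δ(L⁺_v)` on `𝒮(𝔸_f^{n″})` read through the `κ`-model's chirp (letter `hρf` of p02's TIE, on ★ p863869's `cMat` bytes; ★ p863696 supplies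
`ρf`), there EXIST `π b a v βloc χ` with ALL of U2a's structure and model letters
`hσ hσF hπ hψ hb ha hu hρm hherm hdet hχ hχS` — assembled BY NAME from ★ p863716 (`hσ`), ★ p864061 (`hσF∕ha`, `π hπ`, `hψ`, `βloc χ hherm hdet hχ hχS`), ★ p864126 (`hb`),
★ p864243 (`hρm` core `finSdChar_chirp_eq`) and ★ p863978 (`hu`).  The 2 × 2 currency is reached through `ρ` (`trace_reindex_mul_reindex`, `reindex_smul_vecMulVec`).
References: [Rallis1984] §4; [KudlaRallis1994] §3; [Kudla1994] §3; [Weil1964] n° 13; [Shimura1997] §18.1; [CasselsFrohlichANT1967] Ch. II §14, Ch. XV §2.2.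
HONEST LABEL: HC_CM is proved only modulo the 7 printed citations (2 remaining named inputs: hLiu418 = stmt-HodgeConjecture-24832, h413 = stmt-HodgeConjecture-24833)
until rung 0 closes; this file moves no counter; `h2₂` NOT discharged (the TIE with the linear readings `Bl cfS hρ μW fw νN hβ hβtop` is K2Liu-p02's∕the cert's).
-/

set_option autoImplicit false
set_option linter.dupNamespace false -- the mandated namespace repeats `HodgeConjecture.HodgeConjecture`

noncomputable section

open scoped Matrix
open NumberField IsDedekindDomain
open Literature.NumberTheory.Automorphic Literature.NumberTheory.Automorphic.UnitaryGroup Literature.NumberTheory.GaloisRepresentations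
open Literature.NumberTheory.Automorphic.UnitaryGroup.QuadraticCoordinates
open Literature.NumberTheory.GelbartRogawski1991 Literature.NumberTheory.GelbartRogawski1991.GRConstruction
open Literature.NumberTheory.GelbartRogawski1991.UnitaryDualPair (imagUnit imagUnitSq complexConj_imagUnit imagUnit_ne_zero imagUnit_mul_self)
open Literature.NumberTheory.K2Lit.SiegelDoubled
open Literature.NumberTheory.Weil1964

namespace Summit.HodgeConjecture.HodgeConjecture.Cruxes.HLiu418.K2LiuFinLineModelLettersAtPlaceD

open K2LiuSiegelUnipotentFourierDefs (unipDeltaChar skewMatrices)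
open K2LiuSiegelUnipotentLocalDefs (unipDeltaLoc locToAdelic_mem_unipDelta)

/-! ## §1 Re-enumeration glue to the `2 × 2` currency -/

/-- `reindex ρ ρ (a • σ(y) ⊗ y) = a • σ(y ∘ ρ⁻¹) ⊗ (y ∘ ρ⁻¹)`. [folklore] -/
theorem reindex_smul_vecMulVec {A : Type*} [CommRing A] {ι κ : Type*} (ρ : ι ≃ κ) (τ : A → A) (a : A) (y : ι → A) :
    Matrix.reindex ρ ρ (a • Matrix.vecMulVec (τ ∘ y) y) = a • Matrix.vecMulVec (τ ∘ (y ∘ ρ.symm)) (y ∘ ρ.symm) :=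
  rfl

/-! ## §2 The package -/

variable (L : Type) [Field L] [NumberField L] [IsCMField L]
variable {N M n : ℕ} (e : Fin N × Fin M ≃ Fin n)
  (dV : Fin N → L) (hdV : ∀ i, IsCMField.complexConj L (dV i) = dV i)
  (dW : Fin M → L) (hdW : ∀ i, IsCMField.complexConj L (dW i) = dW i)
  (v : HeightOneSpectrum (𝓞 (Fp L)))

/-- **letter `hu` at the instance**: for every `F_v`-bilinear `π` with continuous `π s ·`, the multiplier
`x ↦ ψ_{L⁺,v}(π (b z) (a • σ(v x) ⊗ v x))` of the dressing `b`, the scalar `a` and the chirp vector `v x := y(x_v) ∘ ρ⁻¹` is locally constant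
(★ p863978 `isLocallyConstant_multiplier` + `continuous_chirpVector`, ★ `continuous_finiteAdeleEval`, ★ `continuous_conjLocal`). [cite: Weil1964, n° 13] [cite: Kudla1994, §3] -/
theorem isLocallyConstant_letter (ρ : Fin n ≃ Fin 2) {n'' : ℕ} (e₁ : Fin (n + n) × Fin 1 ≃ Fin n'') (a' : (Fp L)ˣ)
    (π : Matrix (Fin 2) (Fin 2) (LocalRing L v) →ₗ[(v.adicCompletion (Fp L))] Matrix (Fin 2) (Fin 2) (LocalRing L v) →ₗ[(v.adicCompletion (Fp L))] (v.adicCompletion (Fp L))) (hπc : ∀ s, Continuous (π s)) (z : ↥(K2LiuSiegelUnipotentLocalDefs.unipDeltaLoc L e dV hdV dW hdW v)) :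
    IsLocallyConstant fun x : Fin n'' → FiniteAdeleRing (𝓞 (Fp L)) (Fp L) =>
      (((adeleAddCharAt (Fp L) v) (π (Matrix.reindex ρ ρ ((algebraMap L (LocalRing L v) (imagUnit L)) • ((((blk L e dV hdV dW hdW (locToAdelic L e dV hdV dW hdW v (z : UnitaryGroup.localPi L (IsCMField.complexConj L) (n + n) (hermD L e dV hdV dW hdW) v))).toBlocks₁₂).map (fun t : AdeleRing (𝓞 L) L => finiteAdeleToLocal L v t.2)) * (((gramR L e dV hdV dW hdW).map (algebraMap (Fp L) L)).map (algebraMap L (LocalRing L v)))⁻¹))) ((toLocalRing L v (((a' : Fp L) : (v.adicCompletion (Fp L))) / (4 * ((imagUnitSq L : Fp L) : (v.adicCompletion (Fp L)))))) • Matrix.vecMulVec (⇑(conjLocal L (IsCMField.complexConj L) v) ∘ ((fun i : Fin n => toLocalRing L v (((fun i : Fin n => x (((Equiv.prodUnique (Fin (n + n)) (Fin 1)).symm.trans e₁) (e₂ (n := n) (Sum.inl i))) v) ᵥ* ((gramR L e dV hdV dW hdW).map (algebraMap (Fp L) (v.adicCompletion (Fp L))))) i) - 2 * (toLocalRing L v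 ((fun i : Fin n => x (((Equiv.prodUnique (Fin (n + n)) (Fin 1)).symm.trans e₁) (e₂ (n := n) (Sum.inr i))) v) i) * (algebraMap L (LocalRing L v) (imagUnit L)))) ∘ ρ.symm)) ((fun i : Fin n => toLocalRing L v (((fun i : Fin n => x (((Equiv.prodUnique (Fin (n + n)) (Fin 1)).symm.trans e₁) (e₂ (n := n) (Sum.inl i))) v) ᵥ* ((gramR L e dV hdV dW hdW).map (algebraMap (Fp L) (v.adicCompletion (Fp L))))) i) - 2 * (toLocalRing L v ((fun i : Fin n => x (((Equiv.prodUnique (Fin (n + n)) (Fin 1)).symm.trans e₁) (e₂ (n := n) (Sum.inr i))) v) i) * (algebraMap L (LocalRing L v) (imagUnit L)))) ∘ ρ.symm))) : Circle) : ℂ) := by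
  have hp : Continuous fun x : Fin n'' → FiniteAdeleRing (𝓞 (Fp L)) (Fp L) => (fun i : Fin n => x (((Equiv.prodUnique (Fin (n + n)) (Fin 1)).symm.trans e₁) (e₂ (n := n) (Sum.inl i))) v) :=
    continuous_pi fun i => (AdelicGroupData.continuous_finiteAdeleEval (Fp L) v).comp (continuous_apply _)
  have hq : Continuous fun x : Fin n'' → FiniteAdeleRing (𝓞 (Fp L)) (Fp L) => (fun i : Fin n => x (((Equiv.prodUnique (Fin (n + n)) (Fin 1)).symm.trans e₁) (e₂ (n := n) (Sum.inr i))) v) :=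
    continuous_pi fun i => (AdelicGroupData.continuous_finiteAdeleEval (Fp L) v).comp (continuous_apply _)
  have hy := (K2LiuFinChirpLocalGramReading.continuous_chirpVector (Fp L) L v ((gramR L e dV hdV dW hdW).map (algebraMap (Fp L) (v.adicCompletion (Fp L)))) (algebraMap L (LocalRing L v) (imagUnit L))).comp (hp.prodMk hq)
  have hv : Continuous fun x : Fin n'' → FiniteAdeleRing (𝓞 (Fp L)) (Fp L) => ((fun i : Fin n => toLocalRing L v (((fun i : Fin n => x (((Equiv.prodUnique (Fin (n + n)) (Fin 1)).symm.trans e₁) (e₂ (n := n) (Sum.inl i))) v) ᵥ* ((gramR L e dV hdV dW hdW).map (algebraMap (Fp L) (v.adicCompletion (Fp L))))) i) - 2 * (toLocalRing L v ((fun i : Fin n => x (((Equiv.prodUnique (Fin (n + n)) (Fin 1)).symm.trans e₁) (e₂ (n := n) (Sum.inr i))) v) i) * (algebraMap L (LocalRing L v) (imagUnit L)))) ∘ ρ.symm) :=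
    continuous_pi fun j => (continuous_apply (ρ.symm j)).comp hy
  exact K2LiuFinChirpLocalGramReading.isLocallyConstant_multiplier (conjLocal L (IsCMField.complexConj L) v) (continuous_conjLocal L (IsCMField.complexConj L) v) π (adeleAddCharAt (Fp L) v)
    (K2LiuFinChirpLocalGramReading.isLocallyConstant_adeleAddCharAt (Fp L) v)
    (fun z : ↥(K2LiuSiegelUnipotentLocalDefs.unipDeltaLoc L e dV hdV dW hdW v) => Matrix.reindex ρ ρ ((algebraMap L (LocalRing L v) (imagUnit L)) • ((((blk L e dV hdV dW hdW (locToAdelic L e dV hdV dW hdW v (z : UnitaryGroup.localPi L (IsCMField.complexConj L) (n + n) (hermD L e dV hdV dW hdW) v))).toBlocks₁₂).map (fun t : AdeleRing (𝓞 L) L => finiteAdeleToLocal L v t.2)) * (((gramR L e dV hdV dW hdW).map (algebraMap (Fp L) L)).map (algebraMap L (LocalRing L v)))⁻¹))) (fun z => hπc _) (toLocalRing L v (((a' : Fp L) : (v.adicCompletion (Fp L))) / (4 * ((imagUnitSq L : Fp L) : (v.adicCompletion (Fp L))))))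
    (fun x : Fin n'' → FiniteAdeleRing (𝓞 (Fp L)) (Fp L) => ((fun i : Fin n => toLocalRing L v (((fun i : Fin n => x (((Equiv.prodUnique (Fin (n + n)) (Fin 1)).symm.trans e₁) (e₂ (n := n) (Sum.inl i))) v) ᵥ* ((gramR L e dV hdV dW hdW).map (algebraMap (Fp L) (v.adicCompletion (Fp L))))) i) - 2 * (toLocalRing L v ((fun i : Fin n => x (((Equiv.prodUnique (Fin (n + n)) (Fin 1)).symm.trans e₁) (e₂ (n := n) (Sum.inr i))) v) i) * (algebraMap L (LocalRing L v) (imagUnit L)))) ∘ ρ.symm)) hv z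

/-- **letter `hρm` at the instance**: the finite multiplier representation read through the `κ`-model's chirp (`hρf` on ★ p863869's bytes) acts by the functions
`x ↦ ψ_{L⁺,v}(π (b z) (a • σ(v x) ⊗ v x))` (★ p864243 `finSdChar_chirp_eq`, `coe_finMulLM`, re-enumeration `ρ`). [cite: Kudla1994, §3] [cite: Rallis1984, §4] -/
theorem coe_rho_letter (hdV0 : ∀ i, dV i ≠ 0) (hdW0 : ∀ i, dW i ≠ 0) (ρ : Fin n ≃ Fin 2) {n'' : ℕ} (e₁ : Fin (n + n) × Fin 1 ≃ Fin n'') (a' : (Fp L)ˣ)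
    (π : Matrix (Fin 2) (Fin 2) (LocalRing L v) →ₗ[(v.adicCompletion (Fp L))] Matrix (Fin 2) (Fin 2) (LocalRing L v) →ₗ[(v.adicCompletion (Fp L))] (v.adicCompletion (Fp L))) (hπτ : ∀ s H, π s H = Algebra.trace (v.adicCompletion (Fp L)) (LocalRing L v) (s * H).trace)
    (ρf : Representation ℂ ↥(K2LiuSiegelUnipotentLocalDefs.unipDeltaLoc L e dV hdV dW hdW v) (FinSB (Fp L) (Fin n'')))
    (hρf : ∀ (z : ↥(K2LiuSiegelUnipotentLocalDefs.unipDeltaLoc L e dV hdV dW hdW v)) (φ : FinSB (Fp L) (Fin n'')), ρf z φ =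
      finMulLM (finSdChar ((((-⅟(2 : (AdeleRing (𝓞 (Fp L)) (Fp L)))) • ((1 : Matrix (Fin n'') (Fin n'') (AdeleRing (𝓞 (Fp L)) (Fp L)))ᵀ *
          Matrix.reindex ((Equiv.prodUnique (Fin (n + n)) (Fin 1)).symm.trans e₁) ((Equiv.prodUnique (Fin (n + n)) (Fin 1)).symm.trans e₁)
            (Matrix.reindex (e₂ (n := n)) (e₂ (n := n))
            ((algebraMap (Fp L) (AdeleRing (𝓞 (Fp L)) (Fp L)) (a' : Fp L)) •
            (Matrix.fromBlocks 0 1 (-((2 : (AdeleRing (𝓞 (Fp L)) (Fp L))) • (1 : Matrix (Fin n) (Fin n) (AdeleRing (𝓞 (Fp L)) (Fp L))))) 0 *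
            Matrix.fromBlocks ((-((blk L e dV hdV dW hdW (locToAdelic L e dV hdV dW hdW v (z : UnitaryGroup.localPi L (IsCMField.complexConj L) (n + n) (hermD L e dV hdV dW hdW) v))).toBlocks₁₂) - ((blk L e dV hdV dW hdW (locToAdelic L e dV hdV dW hdW v (z : UnitaryGroup.localPi L (IsCMField.complexConj L) (n + n) (hermD L e dV hdV dW hdW) v))).toBlocks₁₂)).map (re (quadraticAdeleEquiv (Fp L) L (IsCMField.complexConj L) (complexConj_imagUnit L) (imagUnit_ne_zero L)).toAddEquiv)) ((algebraMap (Fp L) (AdeleRing (𝓞 (Fp L)) (Fp L)) (imagUnitSq L)) • ((-((blk L e dV hdV dW hdW (locToAdelic L e dV hdV dW hdW v (z : UnitaryGroup.localPi L (IsCMField.complexConj L) (n + n) (hermD L e dV hdV dW hdW) v))).toBlocks₁₂) - ((blk L e dV hdV dW hdW (locToAdelic L e dV hdV dW hdW v (z : UnitaryGroup.localPi L (IsCMField.complexConj L) (n + n) (hermD L e dV hdV dW hdW) v))).toBlocks₁₂)).map (im (quadraticAdeleEquiv (Fp L) L (IsCMField.complexConj L) (complexConj_imagUnit L) (imagUnit_ne_zero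 L)).toAddEquiv) * ((gramR L e dV hdV dW hdW).map (algebraMap (Fp L) (AdeleRing (𝓞 (Fp L)) (Fp L))))⁻¹))
              (((gramR L e dV hdV dW hdW).map (algebraMap (Fp L) (AdeleRing (𝓞 (Fp L)) (Fp L)))) * (-((blk L e dV hdV dW hdW (locToAdelic L e dV hdV dW hdW v (z : UnitaryGroup.localPi L (IsCMField.complexConj L) (n + n) (hermD L e dV hdV dW hdW) v))).toBlocks₁₂) - ((blk L e dV hdV dW hdW (locToAdelic L e dV hdV dW hdW v (z : UnitaryGroup.localPi L (IsCMField.complexConj L) (n + n) (hermD L e dV hdV dW hdW) v))).toBlocks₁₂)).map (im (quadraticAdeleEquiv (Fp L) L (IsCMField.complexConj L) (complexConj_imagUnit L) (imagUnit_ne_zero L)).toAddEquiv)) (((gramR L e dV hdV dW hdW).map (algebraMap (Fp L) (AdeleRing (𝓞 (Fp L)) (Fp L)))) * (-((blk L e dV hdV dW hdW (locToAdelic L e dV hdV dW hdW v (z : UnitaryGroup.localPi L (IsCMField.complexConj L) (n + n) (hermD L e dV hdV dW hdW) v))).toBlocks₁₂) - ((blk L e dV hdV dW hdW (locToAdelic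 L e dV hdV dW hdW v (z : UnitaryGroup.localPi L (IsCMField.complexConj L) (n + n) (hermD L e dV hdV dW hdW) v))).toBlocks₁₂)).map (re (quadraticAdeleEquiv (Fp L) L (IsCMField.complexConj L) (complexConj_imagUnit L) (imagUnit_ne_zero L)).toAddEquiv) * ((gramR L e dV hdV dW hdW).map (algebraMap (Fp L) (AdeleRing (𝓞 (Fp L)) (Fp L))))⁻¹) *
            Matrix.fromBlocks ((⅟(2 : (AdeleRing (𝓞 (Fp L)) (Fp L)))) • (1 : Matrix (Fin n) (Fin n) (AdeleRing (𝓞 (Fp L)) (Fp L)))) 0 0 1)))))).map (RingHom.snd (InfiniteAdeleRing (Fp L)) (FiniteAdeleRing (𝓞 (Fp L)) (Fp L)))))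
        (isLocallyConstant_finSdChar _) φ) (z : ↥(K2LiuSiegelUnipotentLocalDefs.unipDeltaLoc L e dV hdV dW hdW v)) (φ : FinSB (Fp L) (Fin n'')) :
    ((ρf z φ : FinSB (Fp L) (Fin n'')) : (Fin n'' → FiniteAdeleRing (𝓞 (Fp L)) (Fp L)) → ℂ) =
      (fun x => (((adeleAddCharAt (Fp L) v) (π (Matrix.reindex ρ ρ ((algebraMap L (LocalRing L v) (imagUnit L)) • ((((blk L e dV hdV dW hdW (locToAdelic L e dV hdV dW hdW v (z : UnitaryGroup.localPi L (IsCMField.complexConj L) (n + n) (hermD L e dV hdV dW hdW) v))).toBlocks₁₂).map (fun t : AdeleRing (𝓞 L) L => finiteAdeleToLocal L v t.2)) * (((gramR L e dV hdV dW hdW).map (algebraMap (Fp L) L)).map (algebraMap L (LocalRing L v)))⁻¹))) ((toLocalRing L v (((a' : Fp L) : (v.adicCompletion (Fp L))) / (4 * ((imagUnitSq L : Fp L) : (v.adicCompletion (Fp L)))))) • Matrix.vecMulVec (⇑(conjLocal L (IsCMField.complexConj L) v) ∘ ((fun i : Fin n => toLocalRing L v (((fun i : Fin n => x (((Equiv.prodUnique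 (Fin (n + n)) (Fin 1)).symm.trans e₁) (e₂ (n := n) (Sum.inl i))) v) ᵥ* ((gramR L e dV hdV dW hdW).map (algebraMap (Fp L) (v.adicCompletion (Fp L))))) i) - 2 * (toLocalRing L v ((fun i : Fin n => x (((Equiv.prodUnique (Fin (n + n)) (Fin 1)).symm.trans e₁) (e₂ (n := n) (Sum.inr i))) v) i) * (algebraMap L (LocalRing L v) (imagUnit L)))) ∘ ρ.symm)) ((fun i : Fin n => toLocalRing L v (((fun i : Fin n => x (((Equiv.prodUnique (Fin (n + n)) (Fin 1)).symm.trans e₁) (e₂ (n := n) (Sum.inl i))) v) ᵥ* ((gramR L e dV hdV dW hdW).map (algebraMap (Fp L) (v.adicCompletion (Fp L))))) i) - 2 * (toLocalRing L v ((fun i : Fin n => x (((Equiv.prodUnique (Fin (n + n)) (Fin 1)).symm.trans e₁) (e₂ (n := n) (Sum.inr i))) v) i) * (algebraMap L (LocalRing L v) (imagUnit L)))) ∘ ρ.symm))) : Circle) : ℂ)) *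
        ((φ : FinSB (Fp L) (Fin n'')) : (Fin n'' → FiniteAdeleRing (𝓞 (Fp L)) (Fp L)) → ℂ) := by
  rw [hρf, coe_finMulLM]
  funext x
  rw [Pi.mul_apply, K2LiuFinLineModelLettersAtPlaceC.finSdChar_chirp_eq L e dV hdV dW hdW v hdV0 hdW0 e₁ a', hπτ,
    ← reindex_smul_vecMulVec ρ, K2LiuFinLineModelLettersAtPlace.trace_reindex_mul_reindex]

/-- **ALL THE S-LETTERS OF ★ U2a's LINE MODEL AT THE PLACE `v`, IN ONE ∃-PACKAGE** (the twelve conjuncts are, in order, `hσ hσF hπ hψ hb ha hu hρm hherm hdet hχ hχS`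
of ★ p863332 at `σ := conjLocal L c v`, `ψ := adeleAddCharAt (Fp L) v`, `Z := ↥(unipDeltaLoc … v)`, `ι z := ι_v z`; assembled by name from ★ p863716, ★ p864061,
★ p864126, ★ p864243, ★ p863978). [cite: Rallis1984, §4] [cite: KudlaRallis1994, §3] [cite: Kudla1994, §3] [cite: Shimura1997, §18.1 (18.4)] -/
theorem exists_letters (hdV0 : ∀ i, dV i ≠ 0) (hdW0 : ∀ i, dW i ≠ 0) (ρ : Fin n ≃ Fin 2) {n'' : ℕ} (e₁ : Fin (n + n) × Fin 1 ≃ Fin n'') (a' : (Fp L)ˣ)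
    (S : Matrix (Fin n) (Fin n) L)
    (hS : S ∈ skewMatrices ((IsCMField.complexConj L : L ≃ₐ[Fp L] L) : L →+* L) ((gramR L e dV hdV dW hdW).map (algebraMap (Fp L) L)))
    (hSdet : S.det ≠ 0) (ρf : Representation ℂ ↥(K2LiuSiegelUnipotentLocalDefs.unipDeltaLoc L e dV hdV dW hdW v) (FinSB (Fp L) (Fin n'')))
    (hρf : ∀ (z : ↥(K2LiuSiegelUnipotentLocalDefs.unipDeltaLoc L e dV hdV dW hdW v)) (φ : FinSB (Fp L) (Fin n'')), ρf z φ =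
      finMulLM (finSdChar ((((-⅟(2 : (AdeleRing (𝓞 (Fp L)) (Fp L)))) • ((1 : Matrix (Fin n'') (Fin n'') (AdeleRing (𝓞 (Fp L)) (Fp L)))ᵀ *
          Matrix.reindex ((Equiv.prodUnique (Fin (n + n)) (Fin 1)).symm.trans e₁) ((Equiv.prodUnique (Fin (n + n)) (Fin 1)).symm.trans e₁)
            (Matrix.reindex (e₂ (n := n)) (e₂ (n := n))
            ((algebraMap (Fp L) (AdeleRing (𝓞 (Fp L)) (Fp L)) (a' : Fp L)) •
            (Matrix.fromBlocks 0 1 (-((2 : (AdeleRing (𝓞 (Fp L)) (Fp L))) • (1 : Matrix (Fin n) (Fin n) (AdeleRing (𝓞 (Fp L)) (Fp L))))) 0 *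
            Matrix.fromBlocks ((-((blk L e dV hdV dW hdW (locToAdelic L e dV hdV dW hdW v (z : UnitaryGroup.localPi L (IsCMField.complexConj L) (n + n) (hermD L e dV hdV dW hdW) v))).toBlocks₁₂) - ((blk L e dV hdV dW hdW (locToAdelic L e dV hdV dW hdW v (z : UnitaryGroup.localPi L (IsCMField.complexConj L) (n + n) (hermD L e dV hdV dW hdW) v))).toBlocks₁₂)).map (re (quadraticAdeleEquiv (Fp L) L (IsCMField.complexConj L) (complexConj_imagUnit L) (imagUnit_ne_zero L)).toAddEquiv)) ((algebraMap (Fp L) (AdeleRing (𝓞 (Fp L)) (Fp L)) (imagUnitSq L)) • ((-((blk L e dV hdV dW hdW (locToAdelic L e dV hdV dW hdW v (z : UnitaryGroup.localPi L (IsCMField.complexConj L) (n + n) (hermD L e dV hdV dW hdW) v))).toBlocks₁₂) - ((blk L e dV hdV dW hdW (locToAdelic L e dV hdV dW hdW v (z : UnitaryGroup.localPi L (IsCMField.complexConj L) (n + n) (hermD L e dV hdV dW hdW) v))).toBlocks₁₂)).map (im (quadraticAdeleEquiv (Fp L) L (IsCMField.complexConj L) (complexConj_imagUnit L) (imagUnit_ne_zero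 L)).toAddEquiv) * ((gramR L e dV hdV dW hdW).map (algebraMap (Fp L) (AdeleRing (𝓞 (Fp L)) (Fp L))))⁻¹))
              (((gramR L e dV hdV dW hdW).map (algebraMap (Fp L) (AdeleRing (𝓞 (Fp L)) (Fp L)))) * (-((blk L e dV hdV dW hdW (locToAdelic L e dV hdV dW hdW v (z : UnitaryGroup.localPi L (IsCMField.complexConj L) (n + n) (hermD L e dV hdV dW hdW) v))).toBlocks₁₂) - ((blk L e dV hdV dW hdW (locToAdelic L e dV hdV dW hdW v (z : UnitaryGroup.localPi L (IsCMField.complexConj L) (n + n) (hermD L e dV hdV dW hdW) v))).toBlocks₁₂)).map (im (quadraticAdeleEquiv (Fp L) L (IsCMField.complexConj L) (complexConj_imagUnit L) (imagUnit_ne_zero L)).toAddEquiv)) (((gramR L e dV hdV dW hdW).map (algebraMap (Fp L) (AdeleRing (𝓞 (Fp L)) (Fp L)))) * (-((blk L e dV hdV dW hdW (locToAdelic L e dV hdV dW hdW v (z : UnitaryGroup.localPi L (IsCMField.complexConj L) (n + n) (hermD L e dV hdV dW hdW) v))).toBlocks₁₂) - ((blk L e dV hdV dW hdW (locToAdelic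 L e dV hdV dW hdW v (z : UnitaryGroup.localPi L (IsCMField.complexConj L) (n + n) (hermD L e dV hdV dW hdW) v))).toBlocks₁₂)).map (re (quadraticAdeleEquiv (Fp L) L (IsCMField.complexConj L) (complexConj_imagUnit L) (imagUnit_ne_zero L)).toAddEquiv) * ((gramR L e dV hdV dW hdW).map (algebraMap (Fp L) (AdeleRing (𝓞 (Fp L)) (Fp L))))⁻¹) *
            Matrix.fromBlocks ((⅟(2 : (AdeleRing (𝓞 (Fp L)) (Fp L)))) • (1 : Matrix (Fin n) (Fin n) (AdeleRing (𝓞 (Fp L)) (Fp L)))) 0 0 1)))))).map (RingHom.snd (InfiniteAdeleRing (Fp L)) (FiniteAdeleRing (𝓞 (Fp L)) (Fp L)))))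
        (isLocallyConstant_finSdChar _) φ) :
    ∃ (π : Matrix (Fin 2) (Fin 2) (LocalRing L v) →ₗ[(v.adicCompletion (Fp L))] Matrix (Fin 2) (Fin 2) (LocalRing L v) →ₗ[(v.adicCompletion (Fp L))] (v.adicCompletion (Fp L)))
      (b : ↥(K2LiuSiegelUnipotentLocalDefs.unipDeltaLoc L e dV hdV dW hdW v) → Matrix (Fin 2) (Fin 2) (LocalRing L v)) (a : (LocalRing L v)) (vmap : (Fin n'' → FiniteAdeleRing (𝓞 (Fp L)) (Fp L)) → Fin 2 → (LocalRing L v))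
      (βloc : Matrix (Fin 2) (Fin 2) (LocalRing L v)) (χ : ↥(K2LiuSiegelUnipotentLocalDefs.unipDeltaLoc L e dV hdV dW hdW v) →* ℂˣ),
      (∀ t : (LocalRing L v), (conjLocal L (IsCMField.complexConj L) v) ((conjLocal L (IsCMField.complexConj L) v) t) = t) ∧
      (∀ c : (v.adicCompletion (Fp L)), (conjLocal L (IsCMField.complexConj L) v) (algebraMap (v.adicCompletion (Fp L)) (LocalRing L v) c) = algebraMap (v.adicCompletion (Fp L)) (LocalRing L v) c) ∧
      (∀ H : Matrix (Fin 2) (Fin 2) (LocalRing L v), (H.map (conjLocal L (IsCMField.complexConj L) v))ᵀ = H → H ≠ 0 → ∃ s : Matrix (Fin 2) (Fin 2) (LocalRing L v), (s.map (conjLocal L (IsCMField.complexConj L) v))ᵀ = s ∧ π s H ≠ 0) ∧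
      (∃ t : (v.adicCompletion (Fp L)), (((adeleAddCharAt (Fp L) v) t : Circle) : ℂ) ≠ 1) ∧
      (∀ s : Matrix (Fin 2) (Fin 2) (LocalRing L v), (s.map (conjLocal L (IsCMField.complexConj L) v))ᵀ = s → ∃ z, b z = s) ∧
      (conjLocal L (IsCMField.complexConj L) v) a = a ∧
      (∀ z, IsLocallyConstant fun x => (((adeleAddCharAt (Fp L) v) (π (b z) (a • Matrix.vecMulVec (⇑(conjLocal L (IsCMField.complexConj L) v) ∘ vmap x) (vmap x))) : Circle) : ℂ)) ∧
      (∀ (z : ↥(K2LiuSiegelUnipotentLocalDefs.unipDeltaLoc L e dV hdV dW hdW v)) (φ : FinSB (Fp L) (Fin n'')),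
        ((ρf z φ : FinSB (Fp L) (Fin n'')) : (Fin n'' → FiniteAdeleRing (𝓞 (Fp L)) (Fp L)) → ℂ) =
          (fun x => (((adeleAddCharAt (Fp L) v) (π (b z) (a • Matrix.vecMulVec (⇑(conjLocal L (IsCMField.complexConj L) v) ∘ vmap x) (vmap x))) : Circle) : ℂ)) *
            ((φ : FinSB (Fp L) (Fin n'')) : (Fin n'' → FiniteAdeleRing (𝓞 (Fp L)) (Fp L)) → ℂ)) ∧
      (βloc.map (conjLocal L (IsCMField.complexConj L) v))ᵀ = βloc ∧ βloc.det ≠ 0 ∧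
      (∀ z, ((χ z : ℂˣ) : ℂ) = (((adeleAddCharAt (Fp L) v) (π (b z) βloc) : Circle) : ℂ)) ∧
      (∀ z : ↥(K2LiuSiegelUnipotentLocalDefs.unipDeltaLoc L e dV hdV dW hdW v), ((χ z : ℂˣ) : ℂ) =
        (unipDeltaChar L e dV hdV dW hdW S
          (locToAdelic L e dV hdV dW hdW v (z : UnitaryGroup.localPi L (IsCMField.complexConj L) (n + n) (hermD L e dV hdV dW hdW) v)) : ℂ)) := by
  haveI : Algebra.IsQuadraticExtension (Fp L) L := IsCMField.isQuadraticExtension L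
  obtain ⟨π, hπτ, hπ, hπc⟩ := K2LiuFinLineModelLettersAtPlace.exists_pairing L v
  obtain ⟨βloc, χ, hherm, hdet, hχS, hχ⟩ := K2LiuFinLineModelLettersAtPlace.exists_beta_chi L e dV hdV dW hdW v hdV0 hdW0 ρ S hS hSdet
  exact ⟨π, fun z => Matrix.reindex ρ ρ ((algebraMap L (LocalRing L v) (imagUnit L)) • ((((blk L e dV hdV dW hdW (locToAdelic L e dV hdV dW hdW v (z : UnitaryGroup.localPi L (IsCMField.complexConj L) (n + n) (hermD L e dV hdV dW hdW) v))).toBlocks₁₂).map (fun t : AdeleRing (𝓞 L) L => finiteAdeleToLocal L v t.2)) * (((gramR L e dV hdV dW hdW).map (algebraMap (Fp L) L)).map (algebraMap L (LocalRing L v)))⁻¹)), (toLocalRing L v (((a' : Fp L) : (v.adicCompletion (Fp L))) / (4 * ((imagUnitSq L : Fp L) : (v.adicCompletion (Fp L)))))),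
    fun x => ((fun i : Fin n => toLocalRing L v (((fun i : Fin n => x (((Equiv.prodUnique (Fin (n + n)) (Fin 1)).symm.trans e₁) (e₂ (n := n) (Sum.inl i))) v) ᵥ* ((gramR L e dV hdV dW hdW).map (algebraMap (Fp L) (v.adicCompletion (Fp L))))) i) - 2 * (toLocalRing L v ((fun i : Fin n => x (((Equiv.prodUnique (Fin (n + n)) (Fin 1)).symm.trans e₁) (e₂ (n := n) (Sum.inr i))) v) i) * (algebraMap L (LocalRing L v) (imagUnit L)))) ∘ ρ.symm), βloc, χ,
    K2LiuLocalRingTraceForm.conjLocal_involutive (Fp L) L v (IsCMField.complexConj L) (complexConj_imagUnit L) (imagUnit_ne_zero L),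
    fun c => conjLocal_toLocalRing (IsCMField.complexConj L) v c, hπ,
    K2LiuFinLineModelLettersAtPlace.exists_coe_adeleAddCharAt_ne_one L v,
    fun s hs => K2LiuFinLineModelLettersAtPlaceB.exists_unipDeltaLoc_dressing_eq L e dV hdV dW hdW v hdV0 hdW0 ρ s hs,
    conjLocal_toLocalRing (IsCMField.complexConj L) v _,
    fun z => isLocallyConstant_letter L e dV hdV dW hdW v ρ e₁ a' π hπc z,
    fun z φ => coe_rho_letter L e dV hdV dW hdW v hdV0 hdW0 ρ e₁ a' π hπτ ρf hρf z φ,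
    hherm, hdet, fun z => (hχ z).trans (by rw [hπτ]), hχS⟩

end Summit.HodgeConjecture.HodgeConjecture.Cruxes.HLiu418.K2LiuFinLineModelLettersAtPlaceD

end
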